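import Mathlib
import Summits.Ventures.HodgeRepro.Tier4.Common.AdelicDefs
import Summits.Ventures.HodgeRepro.Tier4.Common.AdelicPlaces
import Summits.Ventures.HodgeRepro.Tier4.Common.LocalTorus
import Summits.Ventures.HodgeRepro.Tier4.Common.CompactOpenLevel
import Summits.Ventures.HodgeRepro.Tier4.Common.LevelBasis
import Summits.Ventures.HodgeRepro.Tier4.Line1.RTFSetting
import Summits.Ventures.HodgeRepro.Tier4.Line1.RationalPoints
import Summits.Ventures.HodgeRepro.Tier4.Line1.SecondCountableGA
import Summits.Ventures.HodgeRepro.Tier4.Line1.ConvTest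
import Summits.Ventures.HodgeRepro.Tier4.Line1.CompactAverage
import Summits.Ventures.HodgeRepro.Tier4.Line1.LeftTypeOfMatrixCoeff
import Summits.Ventures.HodgeRepro.Tier4.Line1.ArchMatrixCoeff
import Summits.Ventures.HodgeRepro.Tier4.Line1.FinLevelCompact
import Summits.Ventures.HodgeRepro.Tier4.Line1.IsolatingTestsDeepLevel
import Summits.Ventures.HodgeRepro.Tier4.Line1.FiniteTypeAlgebra
import Summits.Ventures.HodgeRepro.Tier4.Line1.FiniteRankTypeApprox
import Summits.Ventures.HodgeRepro.Tier4.Line1.FiniteRankTypeApproxFibre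
import Summits.Ventures.HodgeRepro.Tier4.Line1.ArchDensity

/-!
# Tier4/Line1/ArchDensityBiInvariant — the instance density with a BI-`K(N)`-INVARIANT approximant: every test
function on `U(W)(𝔸_k)` with compact archimedean part is uniformly approximable, off a fixed bi-invariant compact open
set, by a test function of finite-rank left-`K_f(N) × G_∞`-type which is ALSO bi-`K(N)`-invariant

Blind re-derivation cell `pub-hodge-repro`, Tier 4 (README §9–§10), seat t4-L1-p4 (gen 4), LINE L1; the density half of
t4-plan-1's cut (a) (S14297).  Target tree path `lean/Summits/Ventures/HodgeRepro/Tier4/Line1/ArchDensityBiInvariant.lean`.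
Imports this seat's FiniteRankTypeApproxFibre (the density with the fibre clause) and ArchDensity (the fibre lemmas
`mem_levelK_of_archMat_eq`, coset lemmas), p2's ArchMatrixCoeff / FinLevelCompact / FiniteTypeAlgebra
(`finLevel_antitone`) / ConvTest (`IsTest.exists_nhds_norm_sub_lt`), p3's CompactAverage (the two-sided average), typer-2's
level modules.  0 print.

THE COORDINATES, BI-INVARIANT.  Where ArchDensity covered `X` by right cosets `K_N · x`, this module covers it by the
DOUBLE cosets `K_N · x · K(N)` (`K_N = finLevel W N = K_f(N) × G_∞`, `K(N) = levelK W N`): their characteristic functions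
are left-`K_N`- and right-`K(N)`-invariant; the archimedean entries `archMat W w · i j` are bi-`K(N)`-invariant
(`archMat_eq_one_of_mem_levelK`: `K(N)` has trivial archimedean components).  So the Stone–Weierstrass approximant
`P ∘ Φ` — constant on the fibres of the coordinate map (FiniteRankTypeApproxFibre) — is bi-`K(N)`-invariant without any
averaging of `h`.  The fibre condition for a bi-`K(N)`-invariant `f₀`: two points of `X` in the same double coset with
the same archimedean entries are `y = k · x · b` with `k ∈ K_N` of trivial archimedean part (hence `k ∈ K(N)`,
`mem_levelK_of_archMat_eq`) and `b ∈ K(N)`.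

WHAT IS PROVED.  **`exists_finiteRankLeftType_approx_biInvariant`** (`f₀` continuous, bi-`K(N)`-invariant, vanishing
off a compact open `X` left-`K_N`- and right-`K(N)`-invariant ⇒ `h` test, vanishing off `X`, of finite-rank
left-`finLevel W N`-type, bi-`levelK W N`-invariant, `‖h − f₀‖_∞ ≤ η`) and **`exists_finiteRankLeftType_approx_biInvariant_deep`**
(ANY test `f₀` vanishing off a compact open `X` bi-invariant under `finLevel W N₁` ⇒ a level `N ≠ 0` and such an `h`:
first p3's two-sided average over a deep `K(N)`, `η/2`-close by uniform continuity on both sides, then the theorem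
above).  Nothing here says anything about the status of the Hodge conjecture for CM abelian varieties, which is NOT
proved (HC_CM is NOT proved by anyone in this repository).
-/

set_option autoImplicit false

noncomputable section

namespace Summit.Ventures.HodgeRepro.Tier4.Line1

open NumberField Common Topology
open scoped Pointwise

section DoubleCosetTwo

variable {G : Type} [Group G] [TopologicalSpace G] [IsTopologicalGroup G] (K K₀ : Subgroup G)

omit [TopologicalSpace G] [IsTopologicalGroup G] in
/-- membership in the double coset `K · x · K₀`. -/
theorem mem_doubleCoset₂_iff (x g : G) :
    g ∈ (K : Set G) * {x} * (K₀ : Set G) ↔ ∃ b ∈ K₀, g * b⁻¹ * x⁻¹ ∈ K := by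
  constructor
  · intro hg
    obtain ⟨y, hy, b, hb, rfl⟩ := Set.mem_mul.1 hg
    refine ⟨b, hb, ?_⟩
    rw [mul_inv_cancel_right]
    exact (mem_coset_iff K x y).1 hy
  · rintro ⟨b, hb, h⟩
    have := Set.mul_mem_mul ((mem_coset_iff K x (g * b⁻¹)).2 h) hb
    rwa [inv_mul_cancel_right] at this

omit [TopologicalSpace G] [IsTopologicalGroup G] in
/-- the double coset `K · x · K₀` is left-`K`-invariant. -/
theorem doubleCoset₂_left_invariant {k₀ : G} (hk : k₀ ∈ K) (x g : G) :
    k₀ * g ∈ (K : Set G) * {x} * (K₀ : Set G) ↔ g ∈ (K : Set G) * {x} * (K₀ : Set G) := by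
  rw [mem_doubleCoset₂_iff, mem_doubleCoset₂_iff]
  constructor
  · rintro ⟨b, hb, h⟩
    refine ⟨b, hb, ?_⟩
    rw [mul_assoc, mul_assoc, K.mul_mem_cancel_left hk, ← mul_assoc] at h
    exact h
  · rintro ⟨b, hb, h⟩
    refine ⟨b, hb, ?_⟩
    rw [mul_assoc, mul_assoc, K.mul_mem_cancel_left hk, ← mul_assoc]
    exact h

omit [TopologicalSpace G] [IsTopologicalGroup G] in
/-- the double coset `K · x · K₀` is right-`K₀`-invariant. -/
theorem doubleCoset₂_right_invariant {k₀ : G} (hk : k₀ ∈ K₀) (x g : G) :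
    g * k₀ ∈ (K : Set G) * {x} * (K₀ : Set G) ↔ g ∈ (K : Set G) * {x} * (K₀ : Set G) := by
  rw [mem_doubleCoset₂_iff, mem_doubleCoset₂_iff]
  constructor
  · rintro ⟨b, hb, h⟩
    refine ⟨b * k₀⁻¹, K₀.mul_mem hb (K₀.inv_mem hk), ?_⟩
    have : g * (b * k₀⁻¹)⁻¹ = g * k₀ * b⁻¹ := by group
    rw [this]
    exact h
  · rintro ⟨b, hb, h⟩
    refine ⟨b * k₀, K₀.mul_mem hb hk, ?_⟩
    have : g * k₀ * (b * k₀)⁻¹ = g * b⁻¹ := by group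
    rw [this]
    exact h

omit [TopologicalSpace G] [IsTopologicalGroup G] in
/-- `x ∈ K · x · K₀`. -/
theorem mem_doubleCoset₂_self (x : G) : x ∈ (K : Set G) * {x} * (K₀ : Set G) := by
  have := Set.mul_mem_mul (Set.mul_mem_mul K.one_mem (Set.mem_singleton x)) K₀.one_mem
  simpa using this

/-- the double coset of two compact subgroups is compact. -/
theorem isCompact_doubleCoset₂ (hKc : IsCompact (K : Set G)) (hK₀c : IsCompact (K₀ : Set G)) (x : G) :
    IsCompact ((K : Set G) * {x} * (K₀ : Set G)) :=
  (hKc.mul isCompact_singleton).mul hK₀c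

/-- the double coset `K · x · K₀` of an open `K` is open. -/
theorem isOpen_doubleCoset₂ (hKo : IsOpen (K : Set G)) (x : G) : IsOpen ((K : Set G) * {x} * (K₀ : Set G)) :=
  hKo.mul_right.mul_right

end DoubleCosetTwo

section Entries

variable {k : Type} [Field k] [NumberField k] (W : PlaneData k)

/-- the archimedean standard representation is trivial on the finite part (converse of
`mem_finitePart_of_archMat_eq_one`). -/
theorem archMat_eq_one_of_mem_finitePart {g : GA W} (hg : g ∈ finitePart W) (w : InfinitePlace k) :
    archMat W w g = 1 := by
  rw [mem_finitePart] at hg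
  apply Matrix.ext
  intro i j
  have h1 : archMat W w g i j = InfinitePlace.Completion.extensionEmbedding w
      (((GA.infiniteComponent W w g : GL (Fin 4) w.Completion) : Matrix (Fin 4) (Fin 4) w.Completion) i j) := rfl
  rw [h1, hg w]
  simp only [Units.val_one, Matrix.one_apply]
  split_ifs <;> simp

/-- the archimedean standard representation is trivial on `K(N)`. -/
theorem archMat_eq_one_of_mem_levelK {N : ℕ} {g : GA W} (hg : g ∈ levelK W N) (w : InfinitePlace k) :
    archMat W w g = 1 :=
  archMat_eq_one_of_mem_finitePart W (levelK_le_finitePart W N hg) w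

end Entries

section Density

variable {k : Type} [Field k] [NumberField k] (W : PlaneData k)

/-- **the instance density with a bi-`K(N)`-invariant approximant**: with `hC : IsCompact (archImage W)`, a compact
open `X` left-`finLevel W N`- and right-`levelK W N`-invariant, and `f₀` continuous, bi-`levelK W N`-invariant,
vanishing off `X`, there is for every `η > 0` a test function `h` vanishing off `X`, of finite-rank
left-`finLevel W N`-type, bi-`levelK W N`-invariant, with `‖h − f₀‖_∞ ≤ η`. -/
theorem exists_finiteRankLeftType_approx_biInvariant (hC : IsCompact (archImage W)) {N : ℕ} (hN : N ≠ 0)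
    {X : Set (GA W)} (hXc : IsCompact X) (hXo : IsOpen X) (hKX : ∀ k ∈ finLevel W N, ∀ g, k * g ∈ X ↔ g ∈ X)
    (hXK : ∀ k ∈ levelK W N, ∀ g, g * k ∈ X ↔ g ∈ X)
    {f₀ : GA W → ℂ} (h₀ : Continuous f₀) (hf₀ : ∀ g, g ∉ X → f₀ g = 0)
    (hinv : ∀ k ∈ levelK W N, ∀ g, f₀ (g * k) = f₀ g ∧ f₀ (k * g) = f₀ g) {η : ℝ} (hη : 0 < η) :
    ∃ h : GA W → ℂ, RTF.IsTest h ∧ (∀ g, g ∉ X → h g = 0) ∧ RTF.HasFiniteRankLeftType (finLevel W N) h ∧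
      (∀ k ∈ levelK W N, ∀ g, h (g * k) = h g ∧ h (k * g) = h g) ∧ ∀ g, ‖h g - f₀ g‖ ≤ η := by
  classical
  haveI : T2Space (GA W) := t2Space_GA W
  have hKc : IsCompact (finLevel W N : Set (GA W)) := isCompact_finLevel W hC hN
  have hKo : IsOpen (finLevel W N : Set (GA W)) := isOpen_finLevel W hN
  have hK₀c : IsCompact (levelK W N : Set (GA W)) := isCompact_levelK W hN
  have hle : levelK W N ≤ finLevel W N := levelK_le_finLevel W N
  -- a finite cover of `X` by double cosets `K_N · x · K(N)`
  obtain ⟨t, htX, hcover⟩ := hXc.elim_nhds_subcover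
    (fun x => (finLevel W N : Set (GA W)) * {x} * (levelK W N : Set (GA W)))
    (fun x _ => (isOpen_doubleCoset₂ (finLevel W N) (levelK W N) hKo x).mem_nhds
      (mem_doubleCoset₂_self (finLevel W N) (levelK W N) x))
  -- the coordinates
  let u : ({x // x ∈ t} ⊕ (InfinitePlace k × Fin 4 × Fin 4)) → GA W → ℂ :=
    Sum.elim
      (fun x => ((finLevel W N : Set (GA W)) * {(x : GA W)} * (levelK W N : Set (GA W))).indicator
        fun _ => (1 : ℂ))
      (fun p => fun g => archMat W p.1 g p.2.1 p.2.2)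
  have hu : ∀ i, Continuous (u i) := by
    rintro (x | ⟨w, i, j⟩)
    · exact (RTF.isTest_indicator_of_isCompact_isOpen
        (isCompact_doubleCoset₂ (finLevel W N) (levelK W N) hKc hK₀c x)
        (isOpen_doubleCoset₂ (finLevel W N) (levelK W N) hKo x) 1).cont
    · exact continuous_archMat_entry W w i j
  have hX1 : RTF.HasFiniteRankLeftType (finLevel W N) (X.indicator fun _ => (1 : ℂ)) :=
    RTF.hasFiniteRankLeftType_indicator_of_left_invariant hXc hXo hKX 1
  have hX1t : RTF.IsTest (X.indicator fun _ => (1 : ℂ)) := RTF.isTest_indicator_of_isCompact_isOpen hXc hXo 1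
  have hX1inv : ∀ k ∈ finLevel W N, ∀ g, X.indicator (fun _ => (1 : ℂ)) (k * g) =
      X.indicator (fun _ => (1 : ℂ)) g := by
    intro k hk g
    by_cases hg : g ∈ X
    · rw [Set.indicator_of_mem ((hKX k hk g).2 hg), Set.indicator_of_mem hg]
    · rw [Set.indicator_of_notMem (fun h => hg ((hKX k hk g).1 h)), Set.indicator_of_notMem hg]
  have hut : ∀ i, RTF.HasFiniteRankLeftType (finLevel W N) (X.indicator (u i)) := by
    rintro (x | ⟨w, i, j⟩)
    · have hsub : (finLevel W N : Set (GA W)) * {(x : GA W)} * (levelK W N : Set (GA W)) ⊆ X := by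
        intro g hg
        obtain ⟨y, hy, b, hb, rfl⟩ := Set.mem_mul.1 hg
        obtain ⟨a, ha, x', hx', rfl⟩ := Set.mem_mul.1 hy
        rw [Set.mem_singleton_iff] at hx'
        subst hx'
        exact (hXK b hb (a * (x : GA W))).2 ((hKX a ha (x : GA W)).2 (htX x x.2))
      have : X.indicator (u (Sum.inl x)) =
          ((finLevel W N : Set (GA W)) * {(x : GA W)} * (levelK W N : Set (GA W))).indicator fun _ => (1 : ℂ) := by
        show X.indicator (((finLevel W N : Set (GA W)) * {(x : GA W)} * (levelK W N : Set (GA W))).indicator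
          fun _ => (1 : ℂ)) = _
        rw [Set.indicator_indicator, Set.inter_eq_right.2 hsub]
      rw [this]
      exact RTF.hasFiniteRankLeftType_indicator_of_left_invariant
        (isCompact_doubleCoset₂ (finLevel W N) (levelK W N) hKc hK₀c x)
        (isOpen_doubleCoset₂ (finLevel W N) (levelK W N) hKo x)
        (fun k hk g => doubleCoset₂_left_invariant (finLevel W N) (levelK W N) hk x g) 1
    · have : X.indicator (u (Sum.inr ⟨w, i, j⟩)) =
          RTF.coeffFn (archMat W w) i j (X.indicator fun _ => (1 : ℂ)) := by
        funext g
        by_cases hg : g ∈ X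
        · simp only [u, Sum.elim_inr, Set.indicator_of_mem hg, RTF.coeffFn, one_mul]
        · simp only [u, Sum.elim_inr, Set.indicator_of_notMem hg, RTF.coeffFn, zero_mul]
      rw [this]
      exact RTF.hasFiniteRankLeftType_coeffFn (finLevel W N) (archMat W w) i j _ hX1t hX1inv
        (fun l j => continuous_archMat_entry W w l j)
  -- the coordinates are bi-`K(N)`-invariant
  have hu_right : ∀ i, ∀ k ∈ levelK W N, ∀ g, u i (g * k) = u i g := by
    rintro (x | ⟨w, i, j⟩) k hk g
    · simp only [u, Sum.elim_inl]
      by_cases hg : g ∈ (finLevel W N : Set (GA W)) * {(x : GA W)} * (levelK W N : Set (GA W))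
      · rw [Set.indicator_of_mem ((doubleCoset₂_right_invariant _ _ hk _ g).2 hg), Set.indicator_of_mem hg]
      · rw [Set.indicator_of_notMem (fun h => hg ((doubleCoset₂_right_invariant _ _ hk _ g).1 h)),
          Set.indicator_of_notMem hg]
    · simp only [u, Sum.elim_inr]
      rw [map_mul, archMat_eq_one_of_mem_levelK W hk, mul_one]
  have hu_left : ∀ i, ∀ k ∈ levelK W N, ∀ g, u i (k * g) = u i g := by
    rintro (x | ⟨w, i, j⟩) k hk g
    · simp only [u, Sum.elim_inl]
      by_cases hg : g ∈ (finLevel W N : Set (GA W)) * {(x : GA W)} * (levelK W N : Set (GA W))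
      · rw [Set.indicator_of_mem ((doubleCoset₂_left_invariant _ _ (hle hk) _ g).2 hg), Set.indicator_of_mem hg]
      · rw [Set.indicator_of_notMem (fun h => hg ((doubleCoset₂_left_invariant _ _ (hle hk) _ g).1 h)),
          Set.indicator_of_notMem hg]
    · simp only [u, Sum.elim_inr]
      rw [map_mul, archMat_eq_one_of_mem_levelK W hk, one_mul]
  -- the fibre condition: same double coset and same archimedean entries ⇒ `y = k · x · b`, `k ∈ K(N)`, `b ∈ K(N)`
  have hfib : ∀ x ∈ X, ∀ y ∈ X, (∀ i, u i x = u i y) → f₀ x = f₀ y := by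
    intro x hx y _ huxy
    obtain ⟨s, hs, hxs⟩ := Set.mem_iUnion₂.1 (hcover hx)
    have h1 : u (Sum.inl ⟨s, hs⟩) x = 1 := by
      simp only [u, Sum.elim_inl, Set.indicator_of_mem hxs]
    have hys : y ∈ (finLevel W N : Set (GA W)) * {s} * (levelK W N : Set (GA W)) := by
      by_contra hys
      have h2 : u (Sum.inl ⟨s, hs⟩) y = 0 := by
        simp only [u, Sum.elim_inl, Set.indicator_of_notMem hys]
      have := huxy (Sum.inl ⟨s, hs⟩)
      rw [h1, h2] at this
      exact one_ne_zero this
    obtain ⟨b, hb, hxb⟩ := (mem_doubleCoset₂_iff (finLevel W N) (levelK W N) s x).1 hxs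
    obtain ⟨b', hb', hyb⟩ := (mem_doubleCoset₂_iff (finLevel W N) (levelK W N) s y).1 hys
    -- `y b'⁻¹ · (x b⁻¹)⁻¹ ∈ K_N` with trivial archimedean part
    have hyx : y * b'⁻¹ * (x * b⁻¹)⁻¹ ∈ finLevel W N := by
      have : y * b'⁻¹ * (x * b⁻¹)⁻¹ = (y * b'⁻¹ * s⁻¹) * (x * b⁻¹ * s⁻¹)⁻¹ := by group
      rw [this]
      exact (finLevel W N).mul_mem hyb ((finLevel W N).inv_mem hxb)
    have hent : ∀ (w : InfinitePlace k) (i j : Fin 4),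
        archMat W w (x * b⁻¹) i j = archMat W w (y * b'⁻¹) i j := by
      intro w i j
      rw [map_mul, map_mul, archMat_eq_one_of_mem_levelK W ((levelK W N).inv_mem hb),
        archMat_eq_one_of_mem_levelK W ((levelK W N).inv_mem hb'), mul_one, mul_one]
      exact huxy (Sum.inr ⟨w, i, j⟩)
    have hk : y * b'⁻¹ * (x * b⁻¹)⁻¹ ∈ levelK W N := mem_levelK_of_archMat_eq W hyx hent
    calc f₀ x = f₀ (x * b⁻¹) := ((hinv _ ((levelK W N).inv_mem hb) x).1).symm
      _ = f₀ ((y * b'⁻¹ * (x * b⁻¹)⁻¹) * (x * b⁻¹)) := ((hinv _ hk _).2).symm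
      _ = f₀ (y * b'⁻¹) := by rw [inv_mul_cancel_right]
      _ = f₀ y := (hinv _ ((levelK W N).inv_mem hb') y).1
  obtain ⟨h, hht, hhX, hhtype, hhfib, hhclose⟩ :=
    RTF.exists_finiteRankLeftType_approx_fibre hXc hXo hX1 u hu hut h₀ hf₀ hfib hη
  refine ⟨h, hht, hhX, hhtype, fun k hk g => ⟨?_, ?_⟩, hhclose⟩
  · by_cases hg : g ∈ X
    · exact hhfib _ ((hXK k hk g).2 hg) _ hg fun i => hu_right i k hk g
    · rw [hhX _ hg, hhX _ (fun h => hg ((hXK k hk g).1 h))]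
  · by_cases hg : g ∈ X
    · exact hhfib _ ((hKX k (hle hk) g).2 hg) _ hg fun i => hu_left i k hk g
    · rw [hhX _ hg, hhX _ (fun h => hg ((hKX k (hle hk) g).1 h))]

/-- **the instance density with a bi-invariant approximant, at a deep enough level**: with `hC` and a compact open `X`
bi-invariant under `finLevel W N₁`, every test function `f₀` vanishing off `X` is uniformly `η`-approximable by a test
function vanishing off `X`, of finite-rank left-`finLevel W N`-type and bi-`levelK W N`-invariant, for some level `N ≠ 0`
(first p3's two-sided average over a deep `K(N)` — `η/2`-close by uniform continuity on both sides — then the theorem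
above). -/
theorem exists_finiteRankLeftType_approx_biInvariant_deep [MeasurableSpace (GA W)] [BorelSpace (GA W)]
    (hC : IsCompact (archImage W)) {N₁ : ℕ} (hN₁ : N₁ ≠ 0)
    {X : Set (GA W)} (hXc : IsCompact X) (hXo : IsOpen X) (hKX : ∀ k ∈ finLevel W N₁, ∀ g, k * g ∈ X ↔ g ∈ X)
    (hXK : ∀ k ∈ finLevel W N₁, ∀ g, g * k ∈ X ↔ g ∈ X)
    {f₀ : GA W → ℂ} (h₀ : RTF.IsTest f₀) (hf₀ : ∀ g, g ∉ X → f₀ g = 0) {η : ℝ} (hη : 0 < η) :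
    ∃ N : ℕ, N ≠ 0 ∧ ∃ h : GA W → ℂ, RTF.IsTest h ∧ (∀ g, g ∉ X → h g = 0) ∧
      RTF.HasFiniteRankLeftType (finLevel W N) h ∧
      (∀ k ∈ levelK W N, ∀ g, h (g * k) = h g ∧ h (k * g) = h g) ∧ ∀ g, ‖h g - f₀ g‖ ≤ η := by
  classical
  haveI : T2Space (GA W) := t2Space_GA W
  haveI : SecondCountableTopology (GA W) := secondCountable_GA W
  have hXcl : IsClosed X := hXc.isClosed
  -- uniform continuity on both sides, and a level inside both neighbourhoods
  obtain ⟨VR, hVRn, hVR⟩ := h₀.exists_nhds_norm_sub_lt (show (0 : ℝ) < η / 4 by positivity)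
  obtain ⟨VL, hVLn, hVL⟩ := h₀.exists_nhds_norm_sub_lt_left (show (0 : ℝ) < η / 4 by positivity)
  obtain ⟨N₂, hN₂, hKV⟩ := exists_levelK_subset_nhds_one W (Filter.inter_mem hVRn hVLn)
  have hN : N₁ * N₂ ≠ 0 := mul_ne_zero hN₁ hN₂
  refine ⟨N₁ * N₂, hN, ?_⟩
  have hKc : IsCompact (levelK W (N₁ * N₂) : Set (GA W)) := isCompact_levelK W hN
  have hK2 : levelK W (N₁ * N₂) ≤ levelK W N₂ := levelK_antitone W (dvd_mul_left N₂ N₁)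
  have hK1 : finLevel W (N₁ * N₂) ≤ finLevel W N₁ := finLevel_antitone W (dvd_mul_right N₁ N₂)
  have hKle : levelK W (N₁ * N₂) ≤ finLevel W N₁ := (levelK_le_finLevel W _).trans hK1
  have hKX' : ∀ k ∈ finLevel W (N₁ * N₂), ∀ g, k * g ∈ X ↔ g ∈ X := fun k hk g => hKX k (hK1 hk) g
  have hXK' : ∀ k ∈ levelK W (N₁ * N₂), ∀ g, g * k ∈ X ↔ g ∈ X := fun k hk g => hXK k (hKle hk) g
  have hKR : (levelK W (N₁ * N₂) : Set (GA W)) ⊆ VR := fun x hx => (hKV (hK2 hx)).1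
  have hKL : (levelK W (N₁ * N₂) : Set (GA W)) ⊆ VL := fun x hx => (hKV (hK2 hx)).2
  -- the two-sided average over `K(N)`
  set g₀ : GA W → ℂ := RTF.avgL (levelK W (N₁ * N₂)) hKc (RTF.avgR (levelK W (N₁ * N₂)) hKc f₀) with hg₀def
  have hg₀t : RTF.IsTest g₀ := RTF.isTest_avg (levelK W (N₁ * N₂)) hKc h₀
  have hsuppX : tsupport f₀ ⊆ X := closure_minimal (Function.support_subset_iff'.2 hf₀) hXcl
  have hg₀X : ∀ g, g ∉ X → g₀ g = 0 := by
    intro g hg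
    apply image_eq_zero_of_notMem_tsupport
    intro hmem
    obtain ⟨a, ha, y, hy, rfl⟩ := Set.mem_mul.1 (RTF.tsupport_avg_subset (levelK W (N₁ * N₂)) hKc h₀ hmem)
    obtain ⟨b, hb, c, hc, rfl⟩ := Set.mem_mul.1 hy
    exact hg ((hKX' a (levelK_le_finLevel W _ ha) _).2 ((hXK' c hc b).2 (hsuppX hb)))
  have hg₀inv : ∀ k ∈ levelK W (N₁ * N₂), ∀ g, g₀ (g * k) = g₀ g ∧ g₀ (k * g) = g₀ g :=
    fun k hk g => RTF.avg_invariant (levelK W (N₁ * N₂)) hKc f₀ hk g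
  have hg₀close : ∀ g, ‖g₀ g - f₀ g‖ ≤ η / 2 := by
    intro x
    have hR : ‖RTF.avgR (levelK W (N₁ * N₂)) hKc f₀ x - f₀ x‖ ≤ η / 4 :=
      RTF.norm_avgR_sub_le (levelK W (N₁ * N₂)) hKc h₀ (fun y k hk => (hVR y k (hKR hk)).le) x
    have hLx : ‖g₀ x - RTF.avgR (levelK W (N₁ * N₂)) hKc f₀ x‖ ≤ η / 4 := by
      apply RTF.norm_avgL_sub_le (levelK W (N₁ * N₂)) hKc (RTF.continuous_avgR (levelK W (N₁ * N₂)) hKc h₀)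
      intro y k hk
      exact RTF.norm_avgR_sub_avgR_le (levelK W (N₁ * N₂)) hKc h₀
        (fun z => (hVL z k⁻¹ (hKL ((levelK W (N₁ * N₂)).inv_mem hk))).le) y
    calc ‖g₀ x - f₀ x‖
        = ‖(g₀ x - RTF.avgR (levelK W (N₁ * N₂)) hKc f₀ x) + (RTF.avgR (levelK W (N₁ * N₂)) hKc f₀ x - f₀ x)‖ := by
          congr 1
          ring
      _ ≤ ‖g₀ x - RTF.avgR (levelK W (N₁ * N₂)) hKc f₀ x‖ + ‖RTF.avgR (levelK W (N₁ * N₂)) hKc f₀ x - f₀ x‖ :=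
          norm_add_le _ _
      _ ≤ η / 4 + η / 4 := add_le_add hLx hR
      _ = η / 2 := by ring
  obtain ⟨h, hht, hhX, hhtype, hhinv, hhclose⟩ := exists_finiteRankLeftType_approx_biInvariant W hC hN hXc hXo
    hKX' hXK' hg₀t.cont hg₀X hg₀inv (half_pos hη)
  refine ⟨h, hht, hhX, hhtype, hhinv, fun g => ?_⟩
  calc ‖h g - f₀ g‖ = ‖(h g - g₀ g) + (g₀ g - f₀ g)‖ := by
        congr 1
        ring
    _ ≤ ‖h g - g₀ g‖ + ‖g₀ g - f₀ g‖ := norm_add_le _ _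
    _ ≤ η / 2 + η / 2 := add_le_add (hhclose g) (hg₀close g)
    _ = η := by ring

end Density

end Summit.Ventures.HodgeRepro.Tier4.Line1

end
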